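import Summits.Ventures.HodgeRepro.Night3GSetForm

/-!
# The monomial Gram matrix of the lines, off-diagonal part: `Qc (line σ) (line τ) = 0` for `τ ≠ cσ`

Blind re-derivation cell `pub-hodge-repro`, seat `night-3` (gen 5).  Imports night-3's `Night3GSetForm` (this gen: the
concrete form `Qc = ∫ x ∧ y ∧ Λ` and the diagonal entry `Qc_line_line_conj_ne_zero`).  Namespace
`HodgeRepro.Night3.GSetModel`.

THE THEOREM (NIGHT3.md §11.2 (ii), **`Qc_line_line_eq_zero_of_ne`**): for `n ≥ 1` factors and `τ ≠ cσ`,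
`Qc a (line n σ) (line n τ) = 0`.  With the diagonal entry this is the MONOMIAL GRAM MATRIX of the lines,
`Qc (ℓ_σ, ℓ_τ) ≠ 0 ⟺ τ = cσ` (**`Qc_line_line_ne_zero_iff`**) — the shape the route's cancellation step reads off
(LEMMA-L-P-v2.md step (2): the form pairs the `σ`-line with the `cσ`-line only).

Proof (the same ideal trick as the diagonal entry): if `τ = σ` the wedge `ℓ_σ ∧ ℓ_σ` repeats a vector.  Otherwise the
places of `σ` and `τ` are distinct, with representatives `σ' ≠ τ'` in `Φ₀`; modulo the ideal `J'` generated by the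
`2n` monomials `ωc (i, σ')`, `ωc (i, τ')` — all killed by `ℓ_σ ∧ ℓ_τ` (a repeated vector each) — the class `Λ` is
congruent to `∏_i y_i'^{m−1}` with `y_i'` the sum of the `m − 2` square-zero monomials of the OTHER places, and
`y_i'^{m−1} = 0` (`SqZero.sum_pow_card_succ_eq_zero`).  So `ℓ_σ ∧ ℓ_τ ∧ Λ = 0`.

Nothing here closes S4; nothing here says anything about the status of the Hodge conjecture for CM abelian
varieties, which is NOT proved.
-/

set_option autoImplicit false
open Finset Module Function
open scoped Pointwise IsMulCommutative
namespace HodgeRepro.Night3.GSetModel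

open HodgeRepro.CMHodgeOn ExteriorAlgebra

section Gram

variable {G : Type*} [Group G] [Fintype G] [DecidableEq G] [LinearOrder G]
variable {c : G} {Φ₀ : Finset G} {n : ℕ}

omit [LinearOrder G] in
/-- **`ℓ_σ ∧ ℓ_τ ∧ ωc (i, ρ) = 0` whenever `ρ` or `cρ` is `σ` or `τ`**: the wedge repeats a vector. -/
theorem line_mul_line_mul_ωc_eq_zero (σ τ : G) (i : Fin n) (ρ : G)
    (h : ρ = σ ∨ c * ρ = σ ∨ ρ = τ ∨ c * ρ = τ) :
    (line n σ : ExteriorAlgebra ℂ (V G n)) * line n τ * ωc c n (i, ρ) = 0 := by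
  rw [coe_line_eq, coe_line_eq]
  simp only [ωc, ExtTop.ω_eq_ιMulti, ιMulti_mul_ιMulti]
  apply ιMulti_eq_zero_of_not_inj
  intro hinj
  rcases h with h | h | h | h
  · have := hinj (a₁ := Fin.castAdd 2 (Fin.castAdd n i)) (a₂ := Fin.natAdd (n + n) 0)
      (by rw [Fin.append_left, Fin.append_left, Fin.append_right, Matrix.cons_val_zero, h]; rfl)
    have hv := congrArg Fin.val this
    simp only [Fin.val_castAdd, Fin.val_natAdd, Fin.val_zero] at hv
    omega
  · have := hinj (a₁ := Fin.castAdd 2 (Fin.castAdd n i)) (a₂ := Fin.natAdd (n + n) 1)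
      (by
        rw [Fin.append_left, Fin.append_left, Fin.append_right, Matrix.cons_val_one, Matrix.cons_val_zero]
        show eV n (toLex (i, σ)) = eV n (toLex (i, c * ρ))
        rw [h])
    have hv := congrArg Fin.val this
    simp only [Fin.val_castAdd, Fin.val_natAdd, Fin.val_one] at hv
    omega
  · have := hinj (a₁ := Fin.castAdd 2 (Fin.natAdd n i)) (a₂ := Fin.natAdd (n + n) 0)
      (by rw [Fin.append_left, Fin.append_right, Fin.append_right, Matrix.cons_val_zero, h]; rfl)
    have hv := congrArg Fin.val this
    simp only [Fin.val_castAdd, Fin.val_natAdd, Fin.val_zero] at hv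
    omega
  · have := hinj (a₁ := Fin.castAdd 2 (Fin.natAdd n i)) (a₂ := Fin.natAdd (n + n) 1)
      (by
        rw [Fin.append_left, Fin.append_right, Fin.append_right, Matrix.cons_val_one, Matrix.cons_val_zero]
        show eV n (toLex (i, τ)) = eV n (toLex (i, c * ρ))
        rw [h])
    have hv := congrArg Fin.val this
    simp only [Fin.val_castAdd, Fin.val_natAdd, Fin.val_one] at hv
    omega

omit [Group G] [LinearOrder G] in
/-- `ℓ_σ ∧ ℓ_σ = 0` for `n ≥ 1` (a repeated vector). -/
theorem line_mul_line_self (hn : 0 < n) (σ : G) :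
    (line n σ : ExteriorAlgebra ℂ (V G n)) * line n σ = 0 := by
  rw [coe_line_eq, ιMulti_mul_ιMulti]
  apply ιMulti_eq_zero_of_not_inj
  intro hinj
  have := hinj (a₁ := Fin.castAdd n ⟨0, hn⟩) (a₂ := Fin.natAdd n ⟨0, hn⟩)
    (by rw [Fin.append_left, Fin.append_right])
  have hv := congrArg Fin.val this
  simp only [Fin.val_castAdd, Fin.val_natAdd] at hv
  omega

omit [Fintype G] [LinearOrder G] in
/-- The representative of the place of `σ` satisfies `rep σ = σ ∨ c * rep σ = σ`. -/
theorem rep_eq_or_conj (hc : IsComplexConj c) (σ : G) : rep c Φ₀ σ = σ ∨ c * rep c Φ₀ σ = σ := by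
  rcases rep_eq_or c Φ₀ σ with h | h
  · exact Or.inl h
  · exact Or.inr (by rw [h, conj_conj hc])

omit [Fintype G] [LinearOrder G] in
/-- Distinct places have distinct representatives: `τ ∉ {σ, cσ} ⟹ rep τ ≠ rep σ`. -/
theorem rep_ne_rep (hc : IsComplexConj c) {σ τ : G} (h1 : τ ≠ σ) (h2 : τ ≠ c * σ) :
    rep c Φ₀ τ ≠ rep c Φ₀ σ := by
  intro h
  rcases rep_eq_or c Φ₀ τ with hτ | hτ <;> rcases rep_eq_or c Φ₀ σ with hσ | hσ
  · exact h1 (hτ.symm.trans (h.trans hσ))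
  · exact h2 (hτ.symm.trans (h.trans hσ))
  · exact h2 (by rw [← hσ, ← h, hτ, conj_conj hc])
  · exact h1 (mul_left_cancel (hτ.symm.trans (h.trans hσ)))

/-- The ideal of `Ac` generated by the `2n` monomials `ωc (i, rep σ)`, `ωc (i, rep τ)`. -/
noncomputable abbrev Jστ (c : G) (Φ₀ : Finset G) (n : ℕ) (σ τ : G) : Ideal (Ac c n) :=
  Ideal.span (Set.range (Sum.elim (fun i : Fin n => ωc' c n (i, rep c Φ₀ σ))
    (fun i : Fin n => ωc' c n (i, rep c Φ₀ τ))))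

omit [LinearOrder G] in
/-- **`ℓ_σ ∧ ℓ_τ` kills the ideal `Jστ`.** -/
theorem line_mul_line_mul_coe_eq_zero_of_mem' (hc : IsComplexConj c) (σ τ : G) {z : Ac c n}
    (hz : z ∈ Jστ c Φ₀ n σ τ) :
    (line n σ : ExteriorAlgebra ℂ (V G n)) * line n τ * z = 0 := by
  obtain ⟨r, hr⟩ := Ideal.mem_span_range_iff_exists_fun.mp hz
  rw [← hr, AddSubmonoidClass.coe_finsetSum, Finset.mul_sum]
  refine Finset.sum_eq_zero fun j _ => ?_
  rcases j with i | i
  · rw [Sum.elim_inl, Subalgebra.coe_mul, ExtTop.coe_ω', ← ωc_mul_comm, ← mul_assoc,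
      line_mul_line_mul_ωc_eq_zero σ τ i _ (by
        rcases rep_eq_or_conj (Φ₀ := Φ₀) hc σ with h | h
        · exact Or.inl h
        · exact Or.inr (Or.inl h)), zero_mul]
  · rw [Sum.elim_inr, Subalgebra.coe_mul, ExtTop.coe_ω', ← ωc_mul_comm, ← mul_assoc,
      line_mul_line_mul_ωc_eq_zero σ τ i _ (by
        rcases rep_eq_or_conj (Φ₀ := Φ₀) hc τ with h | h
        · exact Or.inr (Or.inr (Or.inl h))
        · exact Or.inr (Or.inr (Or.inr h))), zero_mul]

/-- The sum of the monomials of the `i`-th factor over the places other than those of `σ` and `τ`. -/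
noncomputable def ySum₂ (c : G) (Φ₀ : Finset G) (a : Fin n → G → ℂ) (σ τ : G) (i : Fin n) : Ac c n :=
  ∑ ρ ∈ (Φ₀.erase (rep c Φ₀ σ)).erase (rep c Φ₀ τ), a i ρ • ωc' c n (i, ρ)

omit [LinearOrder G] in
/-- `L_i = a i σ' • ωc (i, σ') + (a i τ' • ωc (i, τ') + y_i')` for `σ' ≠ τ'`. -/
theorem Lclass_eq_add₂ (hΦ : IsCMType c Φ₀) (a : Fin n → G → ℂ) {σ τ : G} (hστ : rep c Φ₀ τ ≠ rep c Φ₀ σ)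
    (i : Fin n) :
    Lclass c Φ₀ a i = a i (rep c Φ₀ σ) • ωc' c n (i, rep c Φ₀ σ) +
      (a i (rep c Φ₀ τ) • ωc' c n (i, rep c Φ₀ τ) + ySum₂ c Φ₀ a σ τ i) := by
  rw [Lclass, ySum₂, Finset.add_sum_erase (Φ₀.erase (rep c Φ₀ σ)) (fun ρ => a i ρ • ωc' c n (i, ρ))
    (mem_erase.mpr ⟨hστ, rep_mem hΦ τ⟩), Finset.add_sum_erase Φ₀ (fun ρ => a i ρ • ωc' c n (i, ρ)) (rep_mem hΦ σ)]

omit [LinearOrder G] in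
/-- `y_i'^{m−1} = 0`: a sum of `m − 2` square-zero elements (`SqZero.sum_pow_card_succ_eq_zero`). -/
theorem ySum₂_pow (hΦ : IsCMType c Φ₀) (a : Fin n → G → ℂ) {σ τ : G} (hστ : rep c Φ₀ τ ≠ rep c Φ₀ σ)
    (i : Fin n) : ySum₂ c Φ₀ a σ τ i ^ (Φ₀.card - 1) = 0 := by
  have hcard : ((Φ₀.erase (rep c Φ₀ σ)).erase (rep c Φ₀ τ)).card + 1 = Φ₀.card - 1 := by
    rw [card_erase_of_mem (mem_erase.mpr ⟨hστ, rep_mem hΦ τ⟩), card_erase_of_mem (rep_mem hΦ σ)]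
    have h2 : 2 ≤ Φ₀.card := by
      have := Finset.card_le_card (Finset.insert_subset (rep_mem hΦ τ) (Finset.singleton_subset_iff.mpr (rep_mem hΦ σ)))
      rwa [card_insert_of_notMem (by simpa using hστ), card_singleton] at this
    omega
  rw [ySum₂, ← hcard]
  exact SqZero.sum_pow_card_succ_eq_zero _ _ fun ρ _ => by rw [smul_pow, ExtTop.ω'_sq, smul_zero]

omit [LinearOrder G] in
/-- **`Λ ∈ Jστ`** for `n ≥ 1` and distinct places: `Λ ≡ ∏_i y_i'^{m−1} = 0 (mod Jστ)`. -/
theorem Λc_mem (hΦ : IsCMType c Φ₀) (a : Fin n → G → ℂ) (hn : 0 < n) {σ τ : G}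
    (hστ : rep c Φ₀ τ ≠ rep c Φ₀ σ) : Λc c Φ₀ a ∈ Jστ c Φ₀ n σ τ := by
  have h : Λc c Φ₀ a - ∏ i, ySum₂ c Φ₀ a σ τ i ^ (Φ₀.card - 1) ∈ Jστ c Φ₀ n σ τ := by
    unfold Λc
    refine SqZero.prod_sub_prod_mem _ _ _ _ fun i _ => SqZero.pow_sub_pow_mem _ ?_ _
    rw [Lclass_eq_add₂ hΦ a hστ i, ← add_assoc, add_sub_cancel_right]
    exact Ideal.add_mem _ (Submodule.smul_of_tower_mem _ _ (Ideal.subset_span ⟨Sum.inl i, rfl⟩))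
      (Submodule.smul_of_tower_mem _ _ (Ideal.subset_span ⟨Sum.inr i, rfl⟩))
  rwa [Finset.prod_eq_zero (mem_univ ⟨0, hn⟩) (ySum₂_pow hΦ a hστ ⟨0, hn⟩), sub_zero] at h

/-- **THE MONOMIAL GRAM MATRIX, off-diagonal entries: `Qc a (line σ) (line τ) = 0` for `τ ≠ cσ`** (`n ≥ 1`). -/
theorem Qc_line_line_eq_zero_of_ne (hc : IsComplexConj c) (hΦ : IsCMType c Φ₀) (a : Fin n → G → ℂ) (hn : 0 < n)
    {σ τ : G} (hτ : τ ≠ c * σ) : Qc hc hΦ a (line n σ) (line n τ) = 0 := by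
  have key : (line n σ : ExteriorAlgebra ℂ (V G n)) * line n τ * (Λc c Φ₀ a : ExteriorAlgebra ℂ (V G n)) = 0 := by
    by_cases hστ : τ = σ
    · rw [hστ, line_mul_line_self hn, zero_mul]
    · exact line_mul_line_mul_coe_eq_zero_of_mem' hc σ τ (Λc_mem hΦ a hn (rep_ne_rep hc hστ hτ))
  rw [Qc_apply]
  have h0 : (⟨(line n σ : ExteriorAlgebra ℂ (V G n)) * line n τ * Λc c Φ₀ a,
      ExtTop.mul_mul_mem (line n σ) (line n τ) (coe_Λc_mem c Φ₀ a)⟩ :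
      ⋀[ℂ]^(n + n + 2 * (Φ₀.card - 1) * n) (V G n)) = 0 := Subtype.ext key
  rw [h0, map_zero]

/-- **THE MONOMIAL GRAM MATRIX OF THE LINES**: for `n ≥ 1` and non-vanishing coefficients,
`Qc a (line σ) (line τ) ≠ 0 ⟺ τ = cσ` — the form pairs each `σ`-line with the `cσ`-line and with nothing else. -/
theorem Qc_line_line_ne_zero_iff (hc : IsComplexConj c) (hΦ : IsCMType c Φ₀) (a : Fin n → G → ℂ)
    (ha : ∀ i ρ, ρ ∈ Φ₀ → a i ρ ≠ 0) (hn : 0 < n) (σ τ : G) :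
    Qc hc hΦ a (line n σ) (line n τ) ≠ 0 ↔ τ = c * σ := by
  constructor
  · intro h
    by_contra hτ
    exact h (Qc_line_line_eq_zero_of_ne hc hΦ a hn hτ)
  · rintro rfl
    exact Qc_line_line_conj_ne_zero hc hΦ a ha σ

end Gram

end HodgeRepro.Night3.GSetModel
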